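import Summits.BirchSwinnertonDyer.Rank1Residual.X2.IsogenyLineTypeGoodOrdinary
import Summits.BirchSwinnertonDyer.Rank1Residual.Partition.EisensteinKernelReductionLine
import HarnessLib

/-!
# GV CASE 1 ⟹ CASE 2 along the quotient isogeny at a good ordinary prime: the image of a
# RAMIFIED-EVEN kernel line is an UNRAMIFIED-ODD rational line

Support file (prover seat `bsd-schneider-i1-c2`, gen 8, cell `bsd-schneider-ideate`; `--supports
stmt-BirchSwinnertonDyer-19086`). Theorems only; no definition, no named fact.

WHY. On corner A2 (X1 type B: `E[p]` reducible at an anomalous good ordinary odd `p` with the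
Greenberg–Vatsal parity — some rational line `Φ ≤ E[p]` is RAMIFIED-EVEN or UNRAMIFIED-ODD) the
Tamagawa-parity road to T-λ3 (`Literature/…/IsogenyTamagawaParityProofs.lean`: along a rational
`p`-isogeny with `p`-adic-unit period ratio `ord_p ∏c_ℓ(E) + ord_p ∏c_ℓ(E') ≡ rank (mod 2)`,
from Cassels + Cassels–Tate) consumes the KERNEL period clause
`X2.IsogenyPeriodRatio.exists_quot_realPeriodRat_eq_unit_mul` (Greenberg–Vatsal Cor. (3.8): the
quotient by an UNRAMIFIED-ODD line changes `Ω` by a `p`-adic unit). To reach the ramified-even half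
of corner A2 one passes to `E' = E/Φ`: the image line `E[p]/Φ ≤ E'[p]` carries the complementary
character `ωψ⁻¹` — UNRAMIFIED at `p` and ODD. The tree has the other direction
(`X2.IsogenyLineType.isRationalLine_range_and_ramified_even_of_ker`, GV p. 28 "we may assume … `φ`
is ramified and even"); this file proves the mirror statement with the same abstract inputs:

* §1 `isRationalLine_range_and_unramified_odd_of_ker` — pure Galois modules: for an equivariant
  `g : E[p] → E'[p]` with kernel a line `K` RAMIFIED at `p` and EVEN, the image `g(E[p])` is a
  rational line UNRAMIFIED at `p` and ODD, granted (hL₀) Serre's line `L ≤ E[p]` at ONE prime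
  `𝔓 ∣ p` (`(σ − 1)E[p] ⊆ L` for `σ ∈ I_𝔓`, some point of `L` moved by `I_𝔓`) and (hc) the two
  signs of complex conjugation. Mechanism: a line meeting `L` trivially is fixed by `I_𝔓`
  (`σx − x ∈ K ∩ L`), so a RAMIFIED `K` IS `L` ("a ramified rational line is Serre's line"), whence
  `(σ − 1)E[p] ⊆ K = ker g` and `I_𝔓` fixes `g(E[p])` (unramified at one prime above `p`, hence at
  all: `KernelDisc.lineUnramifiedAt_iff_forall_mem_inertia`); if a complex conjugation `c` fixed
  `g(E[p])` then `cP − P ∈ K` is `c`-fixed (EVEN), forcing `c = +1` on `E[p]` against (hc).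
* §2 `exists_rationalLine_unramified_odd_of_isogeny_goodOrd` — for `E/ℚ` globally minimal with good
  ordinary reduction at the odd `p`, `Φ₀` a rational line RAMIFIED at `p` and EVEN, and a
  `ℚ`-isogeny `f : E → E'` with `ker f = Φ₀`: `E'[p]` contains a rational line UNRAMIFIED at `p`
  and ODD ((hL₀) = the reduction line `X2.IsogenyLineTypeGoodOrdinary.exists_reductionLine_adicCompletionPrime`,
  (hc) by the Weil pairing `exists_fixed_and_antifixed_of_isComplexConjugation`).

References: [GreenbergVatsal2000] §2 p. 28 (the reduction between the two parity cases) and p. 26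
("`C[p] = μ_p`"); [Serre1972] §1.11; HOME/memos/i1-c2/FINDING-i1-c2-g8.md.
-/

set_option autoImplicit false

noncomputable section

open scoped Classical AddSubgroup

open WeierstrassCurve Literature.NumberTheory.EllipticCurves Literature.NumberTheory.GaloisRepresentations
  Field IsDedekindDomain NumberField
  Literature.NumberTheory.EllipticCurves.Rank1Residual
  Summit.BirchSwinnertonDyer.Rank1Residual
  Summit.BirchSwinnertonDyer.Rank1Residual.X2.IsogenyLineType
  Summit.BirchSwinnertonDyer.Rank1Residual.X2.IsogenyLineTypeGoodOrdinary

-- `Summit.BirchSwinnertonDyer.BirchSwinnertonDyer.…`: the summit and its single sub-problem share a name (D-0017 layout).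
set_option linter.dupNamespace false

namespace Summit.BirchSwinnertonDyer.BirchSwinnertonDyer.Theorems.DegenerateLocusA2CoLine

variable {W W' : WeierstrassCurve ℚ} {p : ℕ} [hp : Fact p.Prime]

/-! ## §1. Galois modules: the image of a ramified-even kernel line is an unramified-odd line -/

section KernelLine

variable (g : geomTorsion W (p : ℤ) →+ geomTorsion W' (p : ℤ))
  (hg : ∀ (σ : absoluteGaloisGroup ℚ) (P : geomTorsion W (p : ℤ)), g (σ • P) = σ • g P)

include hg in
/-- **The image of a ramified-even kernel line is an unramified-odd rational line.** Let
`g : E[p] → E'[p]` be `Γ_ℚ`-equivariant with kernel `K` of order `p` (`#E[p] = p²`, `p` odd), and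
assume: (hL₀) at SOME prime `𝔓` of `\bar ℤ` above `p` there is a line `L ≤ E[p]` with
`(σ - 1)E[p] ⊆ L` for all `σ ∈ I_𝔓` and some `σ ∈ I_𝔓` moving a point of `L`; (hc) every complex
conjugation has a non-zero fixed and a non-zero anti-fixed point on `E[p]`. If `K` is RAMIFIED at
`p` and EVEN, then `g(E[p]) ≅ E[p]/K` is a rational line of `E'[p]` which is UNRAMIFIED at `p` and
ODD — the mirror of `X2.IsogenyLineType.isRationalLine_range_and_ramified_even_of_ker`
(Greenberg–Vatsal p. 28, the passage between the two parity cases along `E → E/Φ`).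
[cite: GreenbergVatsal2000, §2 p. 28 (reduction to φ ramified and even)] -/
theorem isRationalLine_range_and_unramified_odd_of_ker (hp2 : p ≠ 2)
    (hE : Nat.card (geomTorsion W (p : ℤ)) = p ^ 2)
    (hL₀ : ∃ (v : HeightOneSpectrum (𝓞 ℚ)), (p : 𝓞 ℚ) ∈ v.asIdeal ∧ ∃ 𝔓 ∈ v.primesAbove,
      ∃ L : AddSubgroup (geomTorsion W (p : ℤ)), Nat.card L = p ∧
        (∀ σ ∈ 𝔓.inertia (absoluteGaloisGroup ℚ), ∀ P : geomTorsion W (p : ℤ), σ • P - P ∈ L) ∧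
        (∃ σ ∈ 𝔓.inertia (absoluteGaloisGroup ℚ), ∃ P ∈ L, σ • P ≠ P))
    (hc : ∀ c : absoluteGaloisGroup ℚ, IsComplexConjugation (Rat.castHom ℝ) c →
      (∃ P : geomTorsion W (p : ℤ), P ≠ 0 ∧ c • P = P) ∧
        (∃ Q : geomTorsion W (p : ℤ), Q ≠ 0 ∧ c • Q = -Q))
    (hK : Nat.card g.ker = p) (hr : ¬ LineUnramifiedAt W p g.ker) (he : LineEven W p g.ker) :
    IsRationalLine W' p g.range ∧ LineUnramifiedAt W' p g.range ∧ LineOdd W' p g.range := by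
  have hΨ : IsRationalLine W' p g.range := isRationalLine_range g hg hE hK
  have hKline : IsRationalLine W p g.ker := ⟨hK, fun σ P hP ↦ smul_mem_ker g hg hP⟩
  have hcc2 : ∀ c : absoluteGaloisGroup ℚ, IsComplexConjugation (Rat.castHom ℝ) c →
      ∀ P : geomTorsion W (p : ℤ), c • c • P = P := by
    intro c hcc P
    rw [← mul_smul, ← pow_two, hcc.sq_eq_one, one_smul]
  refine ⟨hΨ, ?_, ?_⟩
  · -- unramified: a RAMIFIED `K` is Serre's line `L` at `𝔓`, so `(σ - 1)E[p] ⊆ ker g`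
    obtain ⟨v, hv, 𝔓, h𝔓, L, hLcard, hLsub, σ₀, hσ₀, x₀, hx₀, hne⟩ := hL₀
    have hKL : g.ker = L := by
      rcases line_eq_or_inf_eq_bot hK hLcard with h | h
      · exact h
      · -- `K ⊓ L = ⊥`: then `I_𝔓` fixes `K`, so `K` is unramified — contradiction
        exfalso
        refine hr ((KernelDisc.lineUnramifiedAt_iff_forall_mem_inertia hKline hv h𝔓).mpr ?_)
        intro σ hσ P hP
        have h1 : σ • P - P ∈ g.ker ⊓ L :=
          AddSubgroup.mem_inf.mpr ⟨g.ker.sub_mem (smul_mem_ker g hg hP) hP, hLsub σ hσ P⟩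
        rw [h, AddSubgroup.mem_bot, sub_eq_zero] at h1
        exact h1
    refine (KernelDisc.lineUnramifiedAt_iff_forall_mem_inertia hΨ hv h𝔓).mpr ?_
    intro σ hσ y hy
    obtain ⟨P, rfl⟩ := AddMonoidHom.mem_range.mp hy
    have h1 : σ • P - P ∈ g.ker := hKL ▸ hLsub σ hσ P
    rw [AddMonoidHom.mem_ker, map_sub, hg] at h1
    exact sub_eq_zero.mp h1
  · -- odd: `c = +1` on `g(E[p])` and on `K` would force `c = +1` on `E[p]`, against (hc)
    intro c hcc y hy
    rcases smul_eq_self_or_eq_neg_of_sq_eq_one hΨ hcc.sq_eq_one with hplus | hminus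
    · exfalso
      obtain ⟨-, ⟨Q₀, hQ₀0, hQ₀⟩⟩ := hc c hcc
      have hall : ∀ P : geomTorsion W (p : ℤ), c • P = P := by
        intro P
        have h1 : c • g P = g P := hplus (g P) (AddMonoidHom.mem_range.mpr ⟨P, rfl⟩)
        have h2 : c • P - P ∈ g.ker := by
          rw [AddMonoidHom.mem_ker, map_sub, hg, h1, sub_self]
        have h3 : c • (c • P - P) = c • P - P := he c hcc _ h2
        rw [smul_sub, hcc2 c hcc P] at h3
        -- `P - cP = cP - P`, so `2 (cP - P) = 0`
        have h4 : (c • P - P) + (c • P - P) = 0 := by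
          nth_rewrite 1 [← h3]
          abel
        have h5 : c • P - P = 0 := eq_zero_of_add_self_eq_zero hp2 h4
        exact sub_eq_zero.mp h5
      have : Q₀ + Q₀ = 0 := by
        have hq := hall Q₀
        rw [hQ₀] at hq
        -- `-Q₀ = Q₀`
        nth_rewrite 1 [← hq]
        exact neg_add_cancel Q₀
      exact hQ₀0 (eq_zero_of_add_self_eq_zero hp2 this)
    · exact hminus y hy

end KernelLine

/-! ## §2. CASE 1 for `E` gives CASE 2 for `E/Φ₀` at a good ordinary prime -/

section Assembly

variable [W.IsElliptic] [W.IsGloballyMinimal]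

/-- **GV CASE 1 for `E` ⟹ CASE 2 for `E' = E/Φ₀`, at a GOOD ORDINARY prime.** Let `E/ℚ` be
globally minimal with good ordinary reduction at the odd prime `p`, `Φ₀ ≤ E[p]` a rational line
RAMIFIED at `p` and EVEN, and `f : E → E'` a `ℚ`-isogeny whose kernel on `ℚ̄`-points is `Φ₀`.
Then `E'[p]` contains a rational line (namely `f(E[p]) ≅ E[p]/Φ₀`) which is UNRAMIFIED at `p` and
ODD — §1 fed with the reduction line (`exists_reductionLine_adicCompletionPrime`: `C_p[p]`, GV
p. 26 "`C[p] = μ_p`") and the Weil-pairing signs of complex conjugation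
(`exists_fixed_and_antifixed_of_isComplexConjugation`). No named fact.
[cite: GreenbergVatsal2000, §2 p. 26 and p. 28] -/
theorem exists_rationalLine_unramified_odd_of_isogeny_goodOrd (hp2 : p ≠ 2)
    (hgood : W.HasGoodReductionAtPrime p) (hord : ¬ (p : ℤ) ∣ W.frobeniusTrace p)
    {Φ₀ : AddSubgroup (geomTorsion W (p : ℤ))} (hΦ : IsRationalLine W p Φ₀)
    (hr : ¬ LineUnramifiedAt W p Φ₀) (he : LineEven W p Φ₀)
    (f : Isogeny W W') (hker : f.toAddMonoidHom.ker = Φ₀.map (geomTorsion W (p : ℤ)).subtype) :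
    ∃ Φ' : AddSubgroup (geomTorsion W' (p : ℤ)),
      IsRationalLine W' p Φ' ∧ LineUnramifiedAt W' p Φ' ∧ LineOdd W' p Φ' := by
  obtain ⟨g, hgval, hg⟩ := exists_restrict_torsion (p := p) f
  -- `ker g = Φ₀`
  have hK : g.ker = Φ₀ := by
    ext P
    rw [AddMonoidHom.mem_ker]
    constructor
    · intro hP
      have h1 : (P : geomPoints W) ∈ f.toAddMonoidHom.ker := by
        rw [AddMonoidHom.mem_ker, Isogeny.coe_toAddMonoidHom, ← hgval, hP]; rfl
      rw [hker] at h1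
      obtain ⟨Q, hQ, hQP⟩ := h1
      have : Q = P := Subtype.ext hQP
      exact this ▸ hQ
    · intro hP
      have h1 : (P : geomPoints W) ∈ f.toAddMonoidHom.ker := by
        rw [hker]; exact ⟨P, hP, rfl⟩
      rw [AddMonoidHom.mem_ker, Isogeny.coe_toAddMonoidHom, ← hgval] at h1
      exact Subtype.ext h1
  have hKcard : Nat.card g.ker = p := by rw [hK]; exact hΦ.1
  obtain ⟨hline, hunr, hodd⟩ := isRationalLine_range_and_unramified_odd_of_ker g hg hp2
    (Rank1Residual.natCard_geomTorsion W p)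
    (exists_reductionLine_adicCompletionPrime W p hp2 hgood hord)
    (exists_fixed_and_antifixed_of_isComplexConjugation W hp2) hKcard (hK ▸ hr) (hK ▸ he)
  exact ⟨g.range, hline, hunr, hodd⟩

end Assembly

end Summit.BirchSwinnertonDyer.BirchSwinnertonDyer.Theorems.DegenerateLocusA2CoLine

end
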